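/-
Copyright (c) 2026 the pub-hodgecm-mathlib formalisation cell (harness21).  Prover seat hodgecm-mathlib-LH4-p08 (g11) (valve hand), Track B «K2-LIT»,
#184♮ = hLiu418 = `stmt-HodgeConjecture-24832`; socket #41, KIND W — (KW-arch-hBL) FILE 2 of KW desk K2E3-p11 (g10)'s census 01:03:09Z, the (0,2)
growth sibling.  THEOREMS ONLY (no `def`, no `instance`, no notation, no named-fact hypothesis, no `sorry`).
-/
import Summits.HodgeConjecture.HodgeConjecture.Theorems.K2LiuKindWArchWhittakerGrowth   -- the (2,0) sibling + the generic-picture growth letter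
import HarnessLib

/-!
# Crux `HLiu418`, socket #41, KIND W — `K2LiuKindWArchWhittakerGrowthNegDef`: GROWTH OF THE CONTINUED PER-PLACE WHITTAKER LETTER AT A NEGATIVE DEFINITE
# FRAMED INDEX (signature (0,2)), by the block-sign mirror

Cell `hodgecm-mathlib`, crux item hLiu418 = `stmt-HodgeConjecture-24832` (helper lane `--supports … --as helper`, count-neutral), route of record `HCCMUnconditional`;
squad K2 ∕ K2Liu, road `K2_Liu`, socket #41, KIND W, (iii-arch) block letter `hBL`.  ★ `K2LiuKindWArchWhittakerGrowth.exists_twistedWhittaker_continuation_growth_of_posDef`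
is the (2,0) growth sibling; THIS FILE is the (0,2) sibling **`exists_twistedWhittaker_continuation_growth_of_negDef`**: ★ p863756's binders VERBATIM
(`hneg : (-hidx).PosDef`), the SAME conclusion (holomorphy ∧ formula ∧ the (ii″) growth face over every hermitian-Levi Iwasawa decomposition of `diag(C,−B)·g`,
entrywise `T₂`, `cg = π∕2`) as the positive case, in the ORIGINAL letters.  PROOF: the block-sign mirror `θ y = D·y·D` (★ p863756 §2): the letter at `(x, g, hidx)`
is ★ `exists_twistedWhittaker_growth_of_posDef_pic` at `(θx, θg, −hidx)` for `F∘θ` (`r ↦ −r` on the chart), and a decomposition `diag(C,−B)·g = n(X₀)·diag(R,R⁻¹)·u₀`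
transports to `diag(−C, B)·θg = n(−X₀)·diag(R,R⁻¹)·(−θu₀)` with the SAME `R` and `h₁ ↦ −h₁` (entrywise norms and `‖det‖` unchanged).
[Shimura1997, §16.4, §18.4] [KudlaRallis1994, §1].
HONEST LABEL.  Count-neutral helper, closes no socket: `HC_CM` is proved only modulo the 7 printed citations (2 remaining named inputs: hLiu418 =
`stmt-HodgeConjecture-24832`, h413 = `stmt-HodgeConjecture-24833`) until rung 0 closes.
-/

set_option autoImplicit false
set_option linter.dupNamespace false -- the mandated namespace repeats `HodgeConjecture.HodgeConjecture`

noncomputable section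

open Complex Matrix MeasureTheory
open scoped ComplexConjugate ComplexOrder
open Literature.NumberTheory.ModularForms.SiegelUpperHalfSpace (moeb)

namespace Summit.HodgeConjecture.HodgeConjecture.Cruxes.HLiu418.K2LiuKindWArchWhittakerGrowthNegDef

open Summit.HodgeConjecture.HodgeConjecture.Cruxes.HLiu418.K2LiuArchInducedTubeDefs
open Summit.HodgeConjecture.HodgeConjecture.Cruxes.HLiu418.K2LiuU22CompactPictureDefs
open Summit.HodgeConjecture.HodgeConjecture.Cruxes.HLiu418.K2LiuSiegelStabBlocks (mem_unitaryGroup_of_stab moeb_I_eq_I_of_mem_unitaryGroup)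
open Summit.HodgeConjecture.HodgeConjecture.Cruxes.HLiu418.K2LiuKindWArchWhittakerLetterNegDef
open Summit.HodgeConjecture.HodgeConjecture.Cruxes.HLiu418.K2LiuKindWArchWhittakerGrowth (exists_twistedWhittaker_growth_of_posDef_pic)

/-- **THE PER-PLACE WHITTAKER LETTER WITH GROWTH — NEGATIVE DEFINITE FRAMED INDEX (signature (0,2)).**  ★ p863756's binders VERBATIM (`hneg : (-hidx).PosDef`);
the SAME conclusion and the SAME growth face as the positive case, in the ORIGINAL letters: by the block-sign mirror `θ y = D·y·D` of ★ p863756 the letter at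
`(x, g, hidx)` is §2's letter at `(θx, θg, −hidx)` for `F∘θ`, and a decomposition `diag(C,−B)·g = n(X₀)·diag(R,R⁻¹)·u₀` gives the decomposition
`diag(−C, B)·θg = n(−X₀)·diag(R,R⁻¹)·(−θu₀)` with the SAME `R` and `h₁ ↦ −h₁` (entrywise norms and `‖det‖` unchanged). [cite: Shimura1997, §16.4, §18.4]
[cite: KudlaRallis1994, §1] -/
theorem exists_twistedWhittaker_continuation_growth_of_negDef {k : ℤ} (hk : -2 ≤ k) (Q : Carrier)
    {B C : Matrix (Fin 2) (Fin 2) ℂ}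
    (hx : (fromBlocks 0 B C 0 : Matrix (Fin 2 ⊕ Fin 2) (Fin 2 ⊕ Fin 2) ℂ)ᴴ * Matrix.J (Fin 2) ℂ * (fromBlocks 0 B C 0 : Matrix (Fin 2 ⊕ Fin 2) (Fin 2 ⊕ Fin 2) ℂ) =
      Matrix.J (Fin 2) ℂ)
    {g : Matrix (Fin 2 ⊕ Fin 2) (Fin 2 ⊕ Fin 2) ℂ} (hg : gᴴ * Matrix.J (Fin 2) ℂ * g = Matrix.J (Fin 2) ℂ)
    {hidx : Matrix (Fin 2) (Fin 2) ℂ} (hneg : (-hidx).PosDef)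
    {eb : Matrix (Fin 2) (Fin 2) ℂ → ℂ} (heb : ∀ b, eb b = cexp (-(2 * Real.pi * I) * (hidx * b).trace))
    (hKpic : ∀ k₀ : Matrix (Fin 2 ⊕ Fin 2) (Fin 2 ⊕ Fin 2) ℂ, k₀ᴴ * Matrix.J (Fin 2) ℂ * k₀ = Matrix.J (Fin 2) ℂ →
      moeb k₀ (I • (1 : Matrix (Fin 2) (Fin 2) ℂ)) = I • 1 →
      ∃ P : MvPolynomial (((Fin 2 ⊕ Fin 2) × (Fin 2 ⊕ Fin 2)) ⊕ ((Fin 2 ⊕ Fin 2) × (Fin 2 ⊕ Fin 2))) ℂ,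
        ∀ (s : ℂ) (F : Matrix (Fin 2 ⊕ Fin 2) (Fin 2 ⊕ Fin 2) ℂ → ℂ), IsArchSiegelSection (fun z : ℂ => (conj z / ((‖z‖ : ℝ) : ℂ)) ^ k) s F →
          (∀ (v : Matrix (Fin 2) (Fin 2) ℂ), vᴴ * v = 1 → ∀ hv : v.det ≠ 0,
            F ((2 : ℂ)⁻¹ • fromBlocks (1 + v) (-(I • (1 - v))) (I • (1 - v)) (1 + v) : Matrix (Fin 2 ⊕ Fin 2) (Fin 2 ⊕ Fin 2) ℂ) = evalAt v hv Q) →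
          ∀ u : Matrix (Fin 2 ⊕ Fin 2) (Fin 2 ⊕ Fin 2) ℂ, uᴴ * Matrix.J (Fin 2) ℂ * u = Matrix.J (Fin 2) ℂ → moeb u (I • (1 : Matrix (Fin 2) (Fin 2) ℂ)) = I • 1 →
            F (u * k₀) = MvPolynomial.eval (Sum.elim (fun pq => u pq.1 pq.2) (fun pq => conj (u pq.1 pq.2))) P) :
    ∃ (Ew : ℂ → ℂ) (s₀ : ℝ), DifferentiableOn ℂ Ew {s : ℂ | 0 < s.re} ∧
      (∀ s : ℂ, s₀ < s.re →
        ∀ F : Matrix (Fin 2 ⊕ Fin 2) (Fin 2 ⊕ Fin 2) ℂ → ℂ, IsArchSiegelSection (fun z : ℂ => (conj z / ((‖z‖ : ℝ) : ℂ)) ^ k) s F →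
          (∀ (v : Matrix (Fin 2) (Fin 2) ℂ), vᴴ * v = 1 → ∀ hv : v.det ≠ 0,
            F ((2 : ℂ)⁻¹ • fromBlocks (1 + v) (-(I • (1 - v))) (I • (1 - v)) (1 + v) : Matrix (Fin 2 ⊕ Fin 2) (Fin 2 ⊕ Fin 2) ℂ) = evalAt v hv Q) →
          ∫ r : Fin 2 → Fin 2 → ℝ, F ((fromBlocks 0 B C 0 : Matrix (Fin 2 ⊕ Fin 2) (Fin 2 ⊕ Fin 2) ℂ) * fromBlocks 1 (hermOfReal r) 0 1 * g) * eb (hermOfReal r) =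
            Ew s) ∧
      ∀ z : ℂ, 0 < z.re → ∃ Cg cg N N' r : ℝ, 0 ≤ Cg ∧ 0 < cg ∧ 0 ≤ N ∧ 0 ≤ N' ∧ 0 < r ∧ ∀ s : ℂ, dist s z < r →
        ∀ (X₀ R : Matrix (Fin 2) (Fin 2) ℂ) (u₀ : Matrix (Fin 2 ⊕ Fin 2) (Fin 2 ⊕ Fin 2) ℂ), X₀ᴴ = X₀ → Rᴴ = R → IsUnit R.det →
          u₀ᴴ * Matrix.J (Fin 2) ℂ * u₀ = Matrix.J (Fin 2) ℂ → moeb u₀ (I • (1 : Matrix (Fin 2) (Fin 2) ℂ)) = I • 1 →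
          (fromBlocks C 0 0 (-B) : Matrix (Fin 2 ⊕ Fin 2) (Fin 2 ⊕ Fin 2) ℂ) * g = fromBlocks 1 X₀ 0 1 * fromBlocks R 0 0 R⁻¹ * u₀ →
          ‖Ew s‖ ≤ Cg * ‖R.det‖ ^ (2 - 2 * s.re) * Real.exp (-(cg * ∑ a, ∑ b, ‖(R * ((C⁻¹)ᴴ * hidx * C⁻¹) * R) a b‖)) *
            (1 + ∑ a, ∑ b, ‖(R * ((C⁻¹)ᴴ * hidx * C⁻¹) * R) a b‖) ^ N * (1 + ‖(R * ((C⁻¹)ᴴ * hidx * C⁻¹) * R).det‖ ^ (-N')) := by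
  -- the mirrored frame `(θx, θg)`, the positive index `−hidx`, the mirrored twist, picture and bridge (as in ★ p863756 §3)
  have hx' : (fromBlocks 0 (-B) (-C) 0 : Matrix (Fin 2 ⊕ Fin 2) (Fin 2 ⊕ Fin 2) ℂ)ᴴ * Matrix.J (Fin 2) ℂ *
      (fromBlocks 0 (-B) (-C) 0 : Matrix (Fin 2 ⊕ Fin 2) (Fin 2 ⊕ Fin 2) ℂ) = Matrix.J (Fin 2) ℂ := by
    have h := conjBlockSign_mem_UJ hx
    rwa [blockSign_mul_antidiag_mul_blockSign] at h
  have heb' : ∀ b : Matrix (Fin 2) (Fin 2) ℂ, (fun b' : Matrix (Fin 2) (Fin 2) ℂ => eb (-b')) b = cexp (-(2 * Real.pi * I) * (-hidx * b).trace) := by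
    intro b
    simp only [heb, Matrix.neg_mul, Matrix.mul_neg]
  obtain ⟨Ew, s₀, hhol, hEw, hgr⟩ := exists_twistedWhittaker_growth_of_posDef_pic hk
    (fun (s : ℂ) (G : Matrix (Fin 2 ⊕ Fin 2) (Fin 2 ⊕ Fin 2) ℂ → ℂ) => ∀ (v : Matrix (Fin 2) (Fin 2) ℂ), vᴴ * v = 1 → ∀ hv : v.det ≠ 0,
      G ((fromBlocks 1 0 0 (-1) : Matrix (Fin 2 ⊕ Fin 2) (Fin 2 ⊕ Fin 2) ℂ) *
          ((2 : ℂ)⁻¹ • fromBlocks (1 + v) (-(I • (1 - v))) (I • (1 - v)) (1 + v) : Matrix (Fin 2 ⊕ Fin 2) (Fin 2 ⊕ Fin 2) ℂ) * fromBlocks 1 0 0 (-1)) =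
        evalAt v hv Q)
    hx' (conjBlockSign_mem_UJ hg) hneg heb'
    (kPicture_conjBlockSign (k := k)
      (fun (s : ℂ) (F : Matrix (Fin 2 ⊕ Fin 2) (Fin 2 ⊕ Fin 2) ℂ → ℂ) => ∀ (v : Matrix (Fin 2) (Fin 2) ℂ), vᴴ * v = 1 → ∀ hv : v.det ≠ 0,
        F ((2 : ℂ)⁻¹ • fromBlocks (1 + v) (-(I • (1 - v))) (I • (1 - v)) (1 + v) : Matrix (Fin 2 ⊕ Fin 2) (Fin 2 ⊕ Fin 2) ℂ) = evalAt v hv Q)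
      hKpic)
  refine ⟨Ew, s₀, hhol, fun s hs F hF hFQ => ?_, fun z hz => ?_⟩
  · -- the formula: `F = (F∘θ)∘θ`, `F∘θ` is flat with the mirrored picture, then `r ↦ −r` on the chart
    have key := hEw s hs (fun y => F ((fromBlocks 1 0 0 (-1) : Matrix (Fin 2 ⊕ Fin 2) (Fin 2 ⊕ Fin 2) ℂ) * y * fromBlocks 1 0 0 (-1)))
      (isArchSiegelSection_conjBlockSign hF)
      (fun v hv hdv => by
        simpa only [Matrix.mul_assoc, blockSign_mul_blockSign_mul, blockSign_mul_blockSign, Matrix.mul_one] using hFQ v hv hdv)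
    rw [← key]
    refine Eq.trans ?_ (integral_neg_eq_self _ volume)
    congr 1
    funext r
    simp only [hermOfReal_neg, neg_neg]
    rw [← blockSign_mul_antidiag_mul_blockSign B C, ← blockSign_mul_transl_mul_blockSign (hermOfReal r)]
    simp only [Matrix.mul_assoc, blockSign_mul_blockSign_mul, blockSign_mul_blockSign, Matrix.mul_one]
  · -- the growth face: transport each decomposition of `diag(C,−B)·g` to one of `diag(−C,B)·θg` with the same `R`
    obtain ⟨Cg, cg, N, N', r, hCg, hcg, hN, hN', hr, hface⟩ := hgr z hz
    refine ⟨Cg, cg, N, N', r, hCg, hcg, hN, hN', hr, fun s hs X₀ R u₀ hX₀ hR hRu hu₀J hu₀i hdec => ?_⟩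
    obtain ⟨-, hBC⟩ := K2LiuArchBlockOfFrame.antidiag_letters hx
    have hCu : IsUnit C.det := isUnit_iff_ne_zero.2 (Matrix.isUnit_det_of_left_inverse hBC).ne_zero
    have hCiC : C⁻¹ * C = 1 := Matrix.nonsing_inv_mul C hCu
    -- the mirrored Stab letter `−θu₀`
    have hu₁J : (-((fromBlocks 1 0 0 (-1) : Matrix (Fin 2 ⊕ Fin 2) (Fin 2 ⊕ Fin 2) ℂ) * u₀ * fromBlocks 1 0 0 (-1)))ᴴ * Matrix.J (Fin 2) ℂ *
        (-((fromBlocks 1 0 0 (-1) : Matrix (Fin 2 ⊕ Fin 2) (Fin 2 ⊕ Fin 2) ℂ) * u₀ * fromBlocks 1 0 0 (-1))) = Matrix.J (Fin 2) ℂ := by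
      rw [conjTranspose_neg, Matrix.neg_mul, Matrix.neg_mul, Matrix.mul_neg, neg_neg]
      exact conjBlockSign_mem_UJ hu₀J
    have hu₁i : moeb (-((fromBlocks 1 0 0 (-1) : Matrix (Fin 2 ⊕ Fin 2) (Fin 2 ⊕ Fin 2) ℂ) * u₀ * fromBlocks 1 0 0 (-1)))
        (I • (1 : Matrix (Fin 2) (Fin 2) ℂ)) = I • 1 := by
      refine moeb_I_eq_I_of_mem_unitaryGroup hu₁J ?_
      have hm : (fromBlocks 1 0 0 (-1) : Matrix (Fin 2 ⊕ Fin 2) (Fin 2 ⊕ Fin 2) ℂ) * u₀ * fromBlocks 1 0 0 (-1) ∈ Matrix.unitaryGroup (Fin 2 ⊕ Fin 2) ℂ :=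
        mul_mem (mul_mem blockSign_mem_unitaryGroup (mem_unitaryGroup_of_stab hu₀J hu₀i)) blockSign_mem_unitaryGroup
      rw [Matrix.mem_unitaryGroup_iff] at hm ⊢
      rw [star_neg, neg_mul_neg]
      exact hm
    -- the mirrored decomposition
    have hdec' : (fromBlocks (-C) 0 0 (-(-B)) : Matrix (Fin 2 ⊕ Fin 2) (Fin 2 ⊕ Fin 2) ℂ) *
        ((fromBlocks 1 0 0 (-1) : Matrix (Fin 2 ⊕ Fin 2) (Fin 2 ⊕ Fin 2) ℂ) * g * fromBlocks 1 0 0 (-1)) =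
        fromBlocks 1 (-X₀) 0 1 * fromBlocks R 0 0 R⁻¹ * (-((fromBlocks 1 0 0 (-1) : Matrix (Fin 2 ⊕ Fin 2) (Fin 2 ⊕ Fin 2) ℂ) * u₀ * fromBlocks 1 0 0 (-1))) := by
      -- `diag(−C, B) = −diag(C,−B)·` and `diag(C,−B)` commutes with `D`
      have e1 : (fromBlocks (-C) 0 0 (-(-B)) : Matrix (Fin 2 ⊕ Fin 2) (Fin 2 ⊕ Fin 2) ℂ) * (fromBlocks 1 0 0 (-1) : Matrix (Fin 2 ⊕ Fin 2) (Fin 2 ⊕ Fin 2) ℂ) =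
          -((fromBlocks 1 0 0 (-1) : Matrix (Fin 2 ⊕ Fin 2) (Fin 2 ⊕ Fin 2) ℂ) * fromBlocks C 0 0 (-B)) := by
        rw [fromBlocks_multiply, fromBlocks_multiply, fromBlocks_neg]
        simp only [Matrix.mul_zero, Matrix.zero_mul, add_zero, zero_add, Matrix.one_mul, Matrix.mul_one, Matrix.mul_neg, Matrix.neg_mul, neg_neg,
          neg_zero]
      have e2 : (fromBlocks 1 0 0 (-1) : Matrix (Fin 2 ⊕ Fin 2) (Fin 2 ⊕ Fin 2) ℂ) * fromBlocks 1 X₀ 0 1 * fromBlocks R 0 0 R⁻¹ =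
          fromBlocks 1 (-X₀) 0 1 * fromBlocks R 0 0 R⁻¹ * (fromBlocks 1 0 0 (-1) : Matrix (Fin 2 ⊕ Fin 2) (Fin 2 ⊕ Fin 2) ℂ) := by
        rw [fromBlocks_multiply, fromBlocks_multiply, fromBlocks_multiply, fromBlocks_multiply]
        simp only [Matrix.mul_zero, Matrix.zero_mul, add_zero, zero_add, Matrix.one_mul, Matrix.mul_one, Matrix.mul_neg, Matrix.neg_mul, neg_neg]
      calc (fromBlocks (-C) 0 0 (-(-B)) : Matrix (Fin 2 ⊕ Fin 2) (Fin 2 ⊕ Fin 2) ℂ) *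
            ((fromBlocks 1 0 0 (-1) : Matrix (Fin 2 ⊕ Fin 2) (Fin 2 ⊕ Fin 2) ℂ) * g * fromBlocks 1 0 0 (-1))
          = -((fromBlocks 1 0 0 (-1) : Matrix (Fin 2 ⊕ Fin 2) (Fin 2 ⊕ Fin 2) ℂ) * ((fromBlocks C 0 0 (-B) : Matrix (Fin 2 ⊕ Fin 2) (Fin 2 ⊕ Fin 2) ℂ) * g) *
              fromBlocks 1 0 0 (-1)) := by
            rw [← Matrix.mul_assoc, ← Matrix.mul_assoc, e1]
            simp only [Matrix.neg_mul, Matrix.mul_assoc]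
        _ = fromBlocks 1 (-X₀) 0 1 * fromBlocks R 0 0 R⁻¹ * (-((fromBlocks 1 0 0 (-1) : Matrix (Fin 2 ⊕ Fin 2) (Fin 2 ⊕ Fin 2) ℂ) * u₀ * fromBlocks 1 0 0 (-1))) := by
            rw [hdec, ← Matrix.mul_assoc, ← Matrix.mul_assoc, e2]
            simp only [Matrix.mul_neg, Matrix.mul_assoc]
    have hX₀' : (-X₀)ᴴ = -X₀ := by rw [conjTranspose_neg, hX₀]
    have hb := hface s hs (-X₀) R _ hX₀' hR hRu hu₁J hu₁i hdec'
    -- `h₁ ↦ −h₁`: entrywise norms and `‖det‖` are unchanged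
    have hCneg : (-C)⁻¹ = -C⁻¹ := Matrix.inv_eq_left_inv (by rw [neg_mul_neg, hCiC])
    have hneg1 : R * (((-C)⁻¹)ᴴ * (-hidx) * (-C)⁻¹) * R = -(R * ((C⁻¹)ᴴ * hidx * C⁻¹) * R) := by
      rw [hCneg, conjTranspose_neg, neg_mul_neg, Matrix.mul_neg, Matrix.mul_neg, Matrix.neg_mul]
    rw [hneg1, Matrix.det_neg, norm_mul, norm_pow, norm_neg, norm_one, one_pow, one_mul] at hb
    simpa only [Matrix.neg_apply, norm_neg] using hb

end Summit.HodgeConjecture.HodgeConjecture.Cruxes.HLiu418.K2LiuKindWArchWhittakerGrowthNegDef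

end
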